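import Literature.AlgebraicTopology.SingularHomology.RelativeCochains
import Mathlib.Algebra.Homology.HomologySequenceLemmas
import HarnessLib

/-!
# Maps of pairs in relative singular cohomology: functoriality and naturality of `δ`

A. Hatcher, *Algebraic Topology* (2002), §3.1, p. 200 (with §2.1 p. 127 dualised): a map of
pairs `f : (X, A) → (Y, B)` (`f(A) ⊆ B`) induces `f♯ : Cⁿ(Y, B; G) → Cⁿ(X, A; G)` and
`f^* : Hⁿ(Y, B; G) → Hⁿ(X, A; G)`, and the long exact sequences of the two pairs form a
commutative ladder ("naturality").

For the relative cochains `relCochainComplex R M A` of `RelativeCochains.lean` we define and prove: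

* `relCochainComplex.map R M f h : C^•(Y, B; M) ⟶ C^•(X, A; M)` (`h : MapsTo f A B`), its
  functoriality (`map_id`, `map_comp`) and compatibility with the inclusion into absolute
  cochains (`map_comp_ι`);
* `relSingularCohomology.map R M f h n : Hⁿ(Y, B; M) ⟶ Hⁿ(X, A; M)`, functorial, with the
  naturality squares `map_comp_toAbsolute` (with `Hⁿ(X, A) → Hⁿ(X)`) and **`δ_comp_map`**
  (`f^* ∘ δ = δ ∘ (f|_A)^*`, from Mathlib's naturality of the connecting homomorphism for the
  morphism of short exact sequences `mapRelShortComplex f h`).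

Everything is proved; no named facts.

## References

* A. Hatcher, *Algebraic Topology*, CUP 2002, §3.1 p. 200, §2.1 p. 127. [Hatcher2002]
-/

noncomputable section

open CategoryTheory

universe u v

namespace Literature.AlgebraicTopology.SingularHomology

variable {R : Type v} [CommRing R] {M : Type v} [AddCommGroup M] [Module R M]
variable {X Y Z : Type u} [TopologicalSpace X] [TopologicalSpace Y] [TopologicalSpace Z]

open CategoryTheory singularCochainComplex relCochainComplex

/-! ### Pull-back of relative cochains along a map of pairs -/

/-- A map of pairs `f : (X, A) → (Y, B)` pulls relative cochains of `(Y, B)` back to relative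
cochains of `(X, A)` (Hatcher 2002, §3.1 p. 200: "`f♯` takes `Cⁿ(Y, B; G)` to `Cⁿ(X, A; G)`").
[cite: Hatcher2002, §3.1 p. 200] -/
lemma map_mem_relCochains {A : Set X} {B : Set Y} (f : C(X, Y)) (h : Set.MapsTo f A B) {n : ℕ}
    {φ : SingularSimplex Y n → M} (hφ : φ ∈ relCochains R M B n) :
    ((singularCochainComplex.map R M f).f n φ : SingularSimplex X n → M) ∈ relCochains R M A n := by
  intro σ hσ
  rw [singularCochainComplex.map_apply]
  refine hφ _ ?_
  rw [SingularSimplex.range_map]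
  exact (Set.image_mono hσ).trans h.image_subset

namespace relCochainComplex

variable (R M)

/-- The cochain map `f♯ : C^•(Y, B; M) ⟶ C^•(X, A; M)` of a map of pairs `f : (X, A) → (Y, B)`
(Hatcher 2002, §3.1 p. 200). [cite: Hatcher2002, §3.1 p. 200] -/
def map {A : Set X} {B : Set Y} (f : C(X, Y)) (h : Set.MapsTo f A B) :
    relCochainComplex R M B ⟶ relCochainComplex R M A where
  f n := ModuleCat.ofHom (((singularCochainComplex.map R M f).f n).hom.restrict
    fun _ hφ => map_mem_relCochains f h hφ)
  comm' i j hij := by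
    change i + 1 = j at hij
    subst hij
    refine ModuleCat.hom_ext (LinearMap.ext fun φ => relCochainComplex.val_injective ?_)
    change val ((relCochainComplex R M A).d i (i + 1) _) = _
    rw [val_d]
    change (singularCochainComplex R M X).d i (i + 1) ((singularCochainComplex.map R M f).f i (val φ)) =
      (singularCochainComplex.map R M f).f (i + 1) (val ((relCochainComplex R M B).d i (i + 1) φ))
    rw [val_d, ← ModuleCat.comp_apply, (singularCochainComplex.map R M f).comm, ModuleCat.comp_apply]

variable {R M}

/-- `f♯` on elements: the pulled-back cochain. [folklore] -/
@[simp] lemma val_map_f {A : Set X} {B : Set Y} (f : C(X, Y)) (h : Set.MapsTo f A B) {n : ℕ}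
    (φ : (relCochainComplex R M B).X n) :
    val ((map R M f h).f n φ) = (singularCochainComplex.map R M f).f n (val φ) := rfl

/-- `f♯` is compatible with the inclusions into absolute cochains. [folklore] -/
lemma map_comp_ι {A : Set X} {B : Set Y} (f : C(X, Y)) (h : Set.MapsTo f A B) :
    map R M f h ≫ ι R M A = ι R M B ≫ singularCochainComplex.map R M f := rfl

/-- `𝟙♯ = 𝟙`. [folklore] -/
lemma map_id (A : Set X) : map R M (ContinuousMap.id X) (Set.mapsTo_id A) = 𝟙 _ := by
  refine HomologicalComplex.hom_ext _ _ fun n => ModuleCat.hom_ext (LinearMap.ext fun φ =>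
    relCochainComplex.val_injective ?_)
  rw [val_map_f, singularCochainComplex.map_id]
  rfl

/-- `(g ∘ f)♯ = f♯ ∘ g♯`. [folklore] -/
lemma map_comp {A : Set X} {B : Set Y} {C : Set Z} (f : C(X, Y)) (g : C(Y, Z))
    (hf : Set.MapsTo f A B) (hg : Set.MapsTo g B C) :
    map R M (g.comp f) (hg.comp hf) = map R M g hg ≫ map R M f hf := by
  refine HomologicalComplex.hom_ext _ _ fun n => ModuleCat.hom_ext (LinearMap.ext fun φ =>
    relCochainComplex.val_injective ?_)
  rw [val_map_f, singularCochainComplex.map_comp]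
  rfl

end relCochainComplex

/-! ### Induced maps on relative cohomology -/

namespace relSingularCohomology

variable (R M)

/-- The induced map `f^* : Hⁿ(Y, B; M) ⟶ Hⁿ(X, A; M)` of a map of pairs (Hatcher 2002, §3.1
p. 200). [cite: Hatcher2002, §3.1 p. 200] -/
abbrev map {A : Set X} {B : Set Y} (f : C(X, Y)) (h : Set.MapsTo f A B) (n : ℕ) :
    relSingularCohomology R M Y B n ⟶ relSingularCohomology R M X A n :=
  HomologicalComplex.homologyMap (relCochainComplex.map R M f h) n

variable {R M}

/-- `𝟙^* = 𝟙` on relative cohomology. [folklore] -/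
lemma map_id (A : Set X) (n : ℕ) : map R M (ContinuousMap.id X) (Set.mapsTo_id A) n = 𝟙 _ := by
  change HomologicalComplex.homologyMap _ n = _
  rw [relCochainComplex.map_id, HomologicalComplex.homologyMap_id]
  rfl

/-- `(g ∘ f)^* = f^* ∘ g^*` on relative cohomology. [folklore] -/
lemma map_comp {A : Set X} {B : Set Y} {C : Set Z} (f : C(X, Y)) (g : C(Y, Z))
    (hf : Set.MapsTo f A B) (hg : Set.MapsTo g B C) (n : ℕ) :
    map R M (g.comp f) (hg.comp hf) n = map R M g hg n ≫ map R M f hf n := by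
  change HomologicalComplex.homologyMap (relCochainComplex.map R M (g.comp f) (hg.comp hf)) n =
    HomologicalComplex.homologyMap (relCochainComplex.map R M g hg) n ≫
      HomologicalComplex.homologyMap (relCochainComplex.map R M f hf) n
  rw [relCochainComplex.map_comp f g hf hg, HomologicalComplex.homologyMap_comp]

/-- The induced maps only depend on the map (proof-irrelevance helper for rewriting the
`MapsTo` witness). [folklore] -/
lemma map_congr {A : Set X} {B : Set Y} {f g : C(X, Y)} (e : f = g) (hf : Set.MapsTo f A B)
    (hg : Set.MapsTo g A B) (n : ℕ) : map R M f hf n = map R M g hg n := by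
  subst e; rfl

/-- **Naturality of `Hⁿ(X, A) → Hⁿ(X)`** under maps of pairs. [cite: Hatcher2002, §3.1 p. 200] -/
lemma map_comp_toAbsolute {A : Set X} {B : Set Y} (f : C(X, Y)) (h : Set.MapsTo f A B) (n : ℕ) :
    map R M f h n ≫ toAbsolute R M X A n = toAbsolute R M Y B n ≫ singularCohomology.map R M f n := by
  change HomologicalComplex.homologyMap (relCochainComplex.map R M f h) n ≫
      HomologicalComplex.homologyMap (ι R M A) n =
    HomologicalComplex.homologyMap (ι R M B) n ≫
      HomologicalComplex.homologyMap (singularCochainComplex.map R M f) n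
  rw [← HomologicalComplex.homologyMap_comp, ← HomologicalComplex.homologyMap_comp,
    relCochainComplex.map_comp_ι]

/-- The restriction `f| : A → B` of a map of pairs, as a continuous map of the subspaces. [folklore] -/
abbrev restrictPair {A : Set X} {B : Set Y} (f : C(X, Y)) (h : Set.MapsTo f A B) : C(A, B) :=
  ⟨h.restrict f A B, (f.continuous.comp continuous_subtype_val).subtype_mk _⟩

/-- The morphism of short exact sequences `(C(Y, B) → C(Y) → C(B)) ⟶ (C(X, A) → C(X) → C(A))`
induced by a map of pairs. [folklore] -/
def mapRelShortComplex {A : Set X} {B : Set Y} (f : C(X, Y)) (h : Set.MapsTo f A B) :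
    relShortComplex R M B ⟶ relShortComplex R M A where
  τ₁ := relCochainComplex.map R M f h
  τ₂ := singularCochainComplex.map R M f
  τ₃ := singularCochainComplex.map R M (restrictPair f h)
  comm₁₂ := rfl
  comm₂₃ := by
    change singularCochainComplex.map R M f ≫ singularCochainComplex.map R M (subsetIncl A) =
      singularCochainComplex.map R M (subsetIncl B) ≫ singularCochainComplex.map R M (restrictPair f h)
    rw [← singularCochainComplex.map_comp, ← singularCochainComplex.map_comp]
    rfl

/-- **Naturality of the coboundary of the pair**: for a map of pairs `f : (X, A) → (Y, B)`,
`f^* ∘ δ_{(Y,B)} = δ_{(X,A)} ∘ (f|_A)^*` (Hatcher 2002, §3.1 p. 200, "naturality" of the long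
exact sequence; §2.1 p. 127). [cite: Hatcher2002, §3.1 p. 200] -/
theorem δ_comp_map {A : Set X} {B : Set Y} (f : C(X, Y)) (h : Set.MapsTo f A B) (i j : ℕ)
    (hij : i + 1 = j) :
    δ R M Y B i j hij ≫ map R M f h j =
      singularCohomology.map R M (restrictPair f h) i ≫ δ R M X A i j hij :=
  HomologicalComplex.HomologySequence.δ_naturality (mapRelShortComplex f h)
    (relShortComplex_shortExact R M B) (relShortComplex_shortExact R M A) i j hij

end relSingularCohomology

end Literature.AlgebraicTopology.SingularHomology
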